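import Summits.BirchSwinnertonDyer.Rank1Residual.P2.Conjectures.CongruentNumberEvenMonskyLawAtTwo
import Summits.BirchSwinnertonDyer.Rank1Residual.P2.Conjectures.CongruentNumberSilentEvenFiveAtTwo
import HarnessLib

/-!
# Sub-lane «bsd-p2»: C-P2-1 IS THE `k = 2` RUNG OF THE UNIFORM EVEN LAW C-P2-2 — bookkeeping between
# the two conjecture `Prop`s modulo Monsky 1990 Cor 5.15 (`h515`) + Monsky's even matrix theorem (`hMe`)
# (nothing asserted, 0 Literature facts, 0 (K), nothing booked, no mark moved)

SECOND FILE next to the typed even law `P2/Conjectures/CongruentNumberEvenMonskyLawAtTwo.lean` (C-P2-2,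
landed as p363094 on p2-lead GEN 9's TYPING WORD WAKE-T-165, bytes T-166b @3d15327a096ceaf0; this file =
WAKE-T-165 (6) / ADDENDUM-1 §4, p2-typer GEN 20 scratch @6065ce22f803bfaa with this docstring refreshed,
Lean terms unchanged; proposed by GEN 24). Purpose: make kernel-visible that with the RULED quantifier
(U) `2 ≤ k` (Monsky's printed scope `ℓ ≥ 2`, WAKE-T-165 (2)) the uniform law SUBSUMES the landed C-P2-1
sentence `CongruentSilentEvenFiveBSDTwo` (p344657): for `p ≡ 5 (mod 8)`, `q ≡ 3 (mod 4)` the pair is a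
`k = 2` cell with `s(2pq) = 1` (read off `#Sel₂ = 8` = Cor 5.15 via `hMe`, no matrix evaluated), so
ONE conjecture token carries rungs `k = 2` (PR-P2-1/3/4, 38 cells HIT), `k = 3` (PR-P2-5/6 = PT16A/PT16B,
32 + 8 HIT, kit j181546 / j186451) and `k = 4` (PR-P2-7 = PT17A HIT 16/16, kit j190768, R1-from-raw PASS
`p2/REFEREE.md` l.436) — EVIDENCE about pairs, 0 (K); p2 column token per the cell lead's RULING R-12.
DESK EVIDENCE (configuration census, `n < 30 000`, typer library `p2/typer/cn`): at `k = 2` the silent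
`s = 1` cells are EXACTLY `𝒮⁻` (446/446); the `s = 1` configurations with `p ≡ 1 (mod 8)` or
`q ≡ 1 (mod 8)` are all `Σ₂′`-odd (loud, Cor 5.15 (3) + TYZ Thm 1.2 side). The converse bookkeeping
(C-P2-1 ⟹ silent `k = 2` rung) is therefore true cell by cell but NOT typed (it needs the sixteen
residue/symbol configurations of Monsky's even `4 × 4` matrix and of `Σ₂′(2pq)` in the kernel).

HONEST FRAMING (sub-lane «bsd-p2», verbatim in every file): the target of record is the FULL
Birch–Swinnerton-Dyer formula for EVERY analytic-rank `≤ 1` `E/ℚ` at ALL primes INCLUDING `2`; the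
`2`-part is OPEN and under census; census output = EVIDENCE, never a Literature fact; certificates close
PAIRS, never classes. This file asserts NO arithmetic fact: kernel implications between conjecture
`Prop`s under the displayed named facts `hMe`, `h515`; neither conjecture is asserted.

References: [Monsky1990MockHeegner] Cor 5.15 (2′)/(3) (p. 66), Remark (3) (p. 67);
[HeathBrown1994SelmerCongruentII] Appendix (Monsky), typescript p. 41 L20–L36; [Miller2011LMS] Def 1.1;
HOME `p2/LEAD-OKS.md` T-153 (BATCH 58), BATCH 70 / 74 / 76 (WAKE-T-165, ADDENDUM-1, GO);
`p2/STRUCTURE-p2.md` v0.18 §3/§6.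
-/

noncomputable section

open scoped Classical

open WeierstrassCurve Literature.NumberTheory.EllipticCurves
  Literature.NumberTheory.EllipticCurves.Rank1Residual
  Literature.NumberTheory.EllipticCurves.Rank1Residual.Typed
  Literature.NumberTheory.EllipticCurves.HeathBrown1994
  Literature.NumberTheory.EllipticCurves.TianYuanZhang2017

set_option autoImplicit false

namespace Summit.BirchSwinnertonDyer.Rank1Residual.P2.Conjectures

open Literature.NumberTheory.EllipticCurves.Monsky1990

/-! ## The `k = 2` rung restricted to `𝒮⁻` IS C-P2-1 (a)+(c): one conjecture token, not two
(modulo Monsky 1990 Cor 5.15 + Monsky's even matrix theorem; nothing asserted) -/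

/-- **`s(n) = 1` on Monsky's Cor 5.15 family (2′)** from the two named facts alone: `hMe` gives
`#Sel₂(E_n) = 2^{2+s(n)}` for `n = 2p₁⋯p_k` (distinct odd primes), `h515` gives `#Sel₂(E_n) = 8` on the
family; hence `s(n) = 1`. No matrix is evaluated. [cite: Monsky1990MockHeegner, Cor. 5.15 (2′) (p. 66)]
[cite: HeathBrown1994SelmerCongruentII, Appendix (Monsky), typescript p. 41 L20–L36] -/
theorem monskySelmerRankEven_eq_one_of_isCor515Family
    (hMe : monsky_card_selmerGroup_two_even) (h515 : cor515_rank_eq_one_and_card_selmerGroup_two)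
    {k : ℕ} (p : Fin k → ℕ) (hp : ∀ i, (p i).Prime) (hodd : ∀ i, Odd (p i))
    (hinj : Function.Injective p) (hN : IsCor515Family (2 * ∏ i, p i)) :
    monskySelmerRankEven p = 1 := by
  haveI := isElliptic_congruentNumberCurve hN.squarefree.ne_zero
  have h8 := (h515 _ hN).2
  rw [hMe k p hp hodd hinj, show (8 : ℕ) = 2 ^ 3 by norm_num] at h8
  have h3 : 2 + monskySelmerRankEven p = 3 := Nat.pow_right_injective le_rfl h8
  omega

/-- **C-P2-1 (a)+(c) on `𝒮⁻` is the `k = 2` rung of the uniform even law**, modulo `hMe` + `h515`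
(only to read `s(2pq) = 1` off `#Sel₂ = 8`): for primes `p ≡ 5 (mod 8)`, `q ≡ 3 (mod 4)` the pair
`(p, q)` is a `k = 2` cell (`2pq ≡ 6 (mod 8)`, `s = 1`), so `CongruentEvenBSDTwoAt 2` delivers
`ord_{s=1} L(E_{2pq}, s) = 1 ∧ BSD(E_{2pq}, 2)` — on BOTH symbol halves; on `(p/q) = −1` that is
`CongruentSilentEvenFiveBSDTwo` (p344657) verbatim. DESK EVIDENCE, not typed: conversely every SILENT
`s = 1` cell at `k = 2` lies in `𝒮⁻` (configuration census `n < 30 000`: 446/446; the other `s = 1`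
configurations `(1,3)`, `(1,7)`, `(3,1)`, `(7,1)` with `(p/q) = −1` are all `Σ₂′`-odd), so the silent
`k = 2` rung and C-P2-1 coincide cell by cell. A kernel implication between conjecture `Prop`s;
asserts neither. [cite: Monsky1990MockHeegner, Cor. 5.15 (2′) (p. 66), Remark (3) (p. 67)]
[cite: Miller2011LMS, Def. 1.1 (arXiv:1010.2431 p. 3)] -/
theorem congruentSilentEvenFiveBSDTwo_of_congruentEvenBSDTwoAt_two
    (hMe : monsky_card_selmerGroup_two_even) (h515 : cor515_rank_eq_one_and_card_selmerGroup_two)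
    (h : CongruentEvenBSDTwoAt 2) : CongruentSilentEvenFiveBSDTwo := by
  intro p q hp hq hp5 hq4 _
  obtain ⟨hN, -, -, hne⟩ := isCor515Family_two_mul_five_mul hp hq hp5 hq4
  have hP : ∀ i, (![p, q] i).Prime := fun i => by fin_cases i <;> assumption
  have hinj : Function.Injective ![p, q] := by
    intro i j hij
    fin_cases i <;> fin_cases j <;> simp_all [eq_comm]
  have hprod : 2 * ∏ i, (![p, q]) i = 2 * (p * q) := by simp [Fin.prod_univ_two]
  have h6 : (2 * (p * q)) % 8 = 6 := by
    have : (p * q) % 4 = 3 := by rw [Nat.mul_mod, show p % 4 = 1 by omega, hq4]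
    omega
  have h8 : (2 * ∏ i, (![p, q]) i) % 8 = 6 := by rw [hprod]; exact h6
  have hodd : ∀ i, Odd (![p, q] i) := odd_of_two_mul_prod_mod_eight_six _ rfl h8
  have hs : monskySelmerRankEven ![p, q] = 1 :=
    monskySelmerRankEven_eq_one_of_isCor515Family hMe h515 _ hP hodd hinj (hprod ▸ hN)
  have h2 := h ![p, q] hP hinj h8 hs
  rw [hprod] at h2
  exact h2

/-- **One token, not two (uniform form):** `CongruentEvenMonskyBSDTwo` (C-P2-2, `k ≥ 2`) implies
C-P2-1's `CongruentSilentEvenFiveBSDTwo`, modulo `hMe` + `h515`. Asserts neither conjecture.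
[cite: Monsky1990MockHeegner, Cor. 5.15 (2′) (p. 66), Remark (3) (p. 67)] [cite: Miller2011LMS, Def. 1.1] -/
theorem congruentSilentEvenFiveBSDTwo_of_congruentEvenMonskyBSDTwo
    (hMe : monsky_card_selmerGroup_two_even) (h515 : cor515_rank_eq_one_and_card_selmerGroup_two)
    (h : CongruentEvenMonskyBSDTwo) : CongruentSilentEvenFiveBSDTwo :=
  congruentSilentEvenFiveBSDTwo_of_congruentEvenBSDTwoAt_two hMe h515 (h 2 le_rfl)

end Summit.BirchSwinnertonDyer.Rank1Residual.P2.Conjectures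

end
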